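import Summits.CriticalPhenomena.PercolationContinuityZ3.Theorems.PercNearOneGluingNoHeavyQuantTransportLight
import HarnessLib

/-!
# QUANT lane R8, Conjecture DIB\* — the TRANSPORT MENU: two-threshold transport, the PURE-MASS row, and the largest-blob split
# with a certified upper tail (light largest blob + rest mean `> 2j` is kernel at floors `x ≥ 43/50`)

builds on p205010 (kernel theorem, internal audit signed; external expert review pending)

Support file (`--supports stmt-CriticalPhenomena-4575`), QUANT lane typer seat prim-quant-stmt (gen 21); sequel of
`…QuantTransportCell` (p275739: `weight_transport_pow`, `transport_tail`, `term_ge_of_transport`, `tail_ge_of_heavyLargest`) and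
`…QuantTransportLight` (p278166: `term_ge_of_transport_lower`, the light-largest cell).  Theorems only, no definitions, no sorries,
standard axioms.

THE MENU (items for the FS / B-S certificates of LEAD-NOTES-G17–G19; every item is a kernel inequality about ONE product measure with
all gates `≥ g₀ ≥ 1/2` and sizes `≤ s`, proved by the Hall + antipodal-Harris injection of `…QuantIndepBlobFar`):
* **T(ℓ, m) — `IndepBlob.transport_two_tails`**: `ℓ + m ≤ Σ a` and `(k − 1)s + ℓ + 1 ≤ m` ⟹ `g₀^k · P(N ≤ ℓ) ≤ (1 − g₀)^k · P(N ≥ m)`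
  (`transport_tail` of the previous file is `m = j + 1`).
* **THE PURE-MASS ROW — `IndepBlob.lowerTail_le_of_mass`**: `Σ a ≥ 2j + 1 + (k − 1)s` ⟹ `g₀^k · P(N ≤ j) ≤ (1 − g₀)^k` (T(j, Σa − j)); for
  Conjecture DIB\* (`g₀ = x²`, `k = 2`): **`RootDec.tail_ge_of_mass` — at every floor `17/20 ≤ x ≤ 1`, every system with gates `≥ x²` and
  total mass `≥ 2j + 1 + (max size)` satisfies `x ≤ P(N ≥ j+1)`**, whatever the credit and whatever the largest blob.
* **THE SPLIT WITH A STRONG REST**: the master rule `RootDec.term_ge_of_transport_lower` (p278166) with `h` from the half-mean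
  small-ball inequality (`IndepBlob.far_indepBlob`: rest mean `> 2j` ⟹ `H ≥ x²`):
  **`RootDec.tail_ge_of_largest_restMean` — at every floor `43/50 ≤ x < 1` (exactly: `2x³ + 2x² ≥ 2x + 1`), every instance with gates
  `≥ x²`, a largest blob of size `≤ j` (ANY gate: light or heavy) and REST MEAN `> 2j` satisfies the row.**
(For `x ≥ 7/8` every normalised instance is already kernel by `tail_ge_of_largest_of_credit` (p278166); the restMean cell adds the sliver
`[43/50, 7/8)` for strong rests and needs no credit hypothesis; the pure-mass row needs neither credit nor a largest blob.)
Numerics (seat folder work/explore/tr4.py, tr5.py, tr6.py): random instances of each statement, 0 violations.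

NOVELTY.  presearch: as for `…QuantTransportCell` (biased EKR / Harris–Kleitman are the only neighbours; none conditioned or two-level).
[this work]; the gluing rows served [cite: KozmaNitzan2024, Conjecture 3 (p. 15)]; product weights [cite: Grimmett1999, §1.3 p. 10].
-/

namespace Summit.CriticalPhenomena.PercolationContinuityZ3.Theorems

namespace Quant

namespace IndepBlob

open Finset

variable {ι : Type*} [Fintype ι] [DecidableEq ι]

/-! ### 1. Two-threshold transport -/

/-- **Transport between two tails, T(ℓ, m).**  Natural sizes `a i ≤ s`, gates `g₀ ≤ p i ≤ 1` with `g₀ ≥ 1/2`, thresholds with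
`ℓ + m ≤ Σ a` and `(k − 1)·s + ℓ + 1 ≤ m`.  Then `g₀^k · P(N ≤ ℓ) ≤ (1 − g₀)^k · P(N ≥ m)`: the configurations of open mass `≤ ℓ`
inject into strict supersets of open mass `≥ m` (`exists_injective_heavy_superset`), opening each time `≥ k` further gates
(added mass `≥ m − ℓ > (k − 1)s`), and `weight_transport_pow`. [this work] -/
theorem transport_two_tails (p : ι → ℝ) (a : ι → ℕ) (g₀ : ℝ) (hhalf : 1 / 2 ≤ g₀) (hp : ∀ i, g₀ ≤ p i) (hp1 : ∀ i, p i ≤ 1)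
    (ℓ m s k : ℕ) (hmass : ℓ + m ≤ ∑ i, a i) (hsize : ∀ i, a i ≤ s) (hk : (k - 1) * s + ℓ + 1 ≤ m) :
    g₀ ^ k * (∑ W ∈ (Finset.univ : Finset (Finset ι)).filter (fun W => ∑ i ∈ W, a i ≤ ℓ),
        (∏ t, if t ∈ W then p t else 1 - p t)) ≤
      (1 - g₀) ^ k * (∑ V ∈ (Finset.univ : Finset (Finset ι)).filter (fun V => m ≤ ∑ i ∈ V, a i),
        (∏ t, if t ∈ V then p t else 1 - p t)) := by
  have hg₀0 : 0 < g₀ := by linarith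
  have hw0' : ∀ W : Finset ι, (∀ i, 0 ≤ p i) → 0 ≤ (∏ t, if t ∈ W then p t else 1 - p t) :=
    fun W h0 => bernoulliWeight_nonneg h0 hp1 W
  have hp0 : ∀ i, 0 ≤ p i := fun i => hg₀0.le.trans (hp i)
  have hw0 : ∀ W : Finset ι, 0 ≤ (∏ t, if t ∈ W then p t else 1 - p t) := fun W => hw0' W hp0
  -- degenerate case `m = 0`: the heavy family is everything
  rcases Nat.eq_zero_or_pos m with hm0 | hm0
  · exfalso; omega
  have hg₀1 : g₀ ≤ 1 := by
    rcases (Finset.univ : Finset ι).eq_empty_or_nonempty with h | ⟨i, -⟩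
    · exfalso
      rw [h, Finset.sum_empty] at hmass
      omega
    · exact (hp i).trans (hp1 i)
  have h1g₀ : 0 ≤ 1 - g₀ := by linarith
  -- real-valued sizes and the injection
  set ar : ι → ℝ := fun i => (a i : ℝ) with har
  have har0 : ∀ i, 0 ≤ ar i := fun i => Nat.cast_nonneg _
  have hcast : ∀ W : Finset ι, ∑ i ∈ W, ar i = ((∑ i ∈ W, a i : ℕ) : ℝ) := fun W => by
    simp only [har, Nat.cast_sum]
  have hle : ((ℓ : ℝ) + 1 / 2) + ((m : ℝ) - 1 / 2) ≤ ∑ i, ar i := by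
    have h1 : ((ℓ + m : ℕ) : ℝ) ≤ ((∑ i, a i : ℕ) : ℝ) := by exact_mod_cast hmass
    rw [hcast]
    push_cast at h1 ⊢
    linarith
  obtain ⟨φ, hφinj, hφ⟩ := exists_injective_heavy_superset ar har0 ((ℓ : ℝ) + 1 / 2) ((m : ℝ) - 1 / 2) hle
  have hlight_iff : ∀ W : Finset ι, ∑ i ∈ W, a i ≤ ℓ ↔ ∑ i ∈ W, ar i < (ℓ : ℝ) + 1 / 2 := by
    intro W
    rw [hcast]
    constructor
    · intro h
      have h' : ((∑ i ∈ W, a i : ℕ) : ℝ) ≤ (ℓ : ℝ) := by exact_mod_cast h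
      linarith
    · intro h
      by_contra hcon
      have h1 : ℓ + 1 ≤ ∑ i ∈ W, a i := by omega
      have h2 : (ℓ : ℝ) + 1 ≤ ((∑ i ∈ W, a i : ℕ) : ℝ) := by exact_mod_cast h1
      linarith
  have hheavy_of : ∀ V : Finset ι, (m : ℝ) - 1 / 2 ≤ ∑ i ∈ V, ar i → m ≤ ∑ i ∈ V, a i := by
    intro V h
    rw [hcast] at h
    by_contra hcon
    have h1 : ∑ i ∈ V, a i + 1 ≤ m := by omega
    have h2 : ((∑ i ∈ V, a i : ℕ) : ℝ) + 1 ≤ (m : ℝ) := by exact_mod_cast h1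
    linarith
  have hLeq : ∑ W ∈ (Finset.univ : Finset (Finset ι)).filter (fun W => ∑ i ∈ W, a i ≤ ℓ),
        (∏ t, if t ∈ W then p t else 1 - p t) =
      ∑ W : {W : Finset ι // ∑ i ∈ W, ar i < (ℓ : ℝ) + 1 / 2}, (∏ t, if t ∈ (W : Finset ι) then p t else 1 - p t) := by
    refine Finset.sum_subtype _ (fun W => ?_) _
    rw [Finset.mem_filter]
    exact ⟨fun h => (hlight_iff W).1 h.2, fun h => ⟨Finset.mem_univ _, (hlight_iff W).2 h⟩⟩
  -- each injection step adds at least `k` gates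
  have hcard : ∀ W : {W : Finset ι // ∑ i ∈ W, ar i < (ℓ : ℝ) + 1 / 2}, k ≤ (φ W \ (W : Finset ι)).card := by
    intro W
    have hWle : ∑ i ∈ (W : Finset ι), a i ≤ ℓ := (hlight_iff W).2 W.2
    have hVge : m ≤ ∑ i ∈ φ W, a i := hheavy_of (φ W) (hφ W).2
    have hsub : (W : Finset ι) ⊆ φ W := (hφ W).1
    have hsplit : ∑ i ∈ φ W, a i = ∑ i ∈ φ W \ (W : Finset ι), a i + ∑ i ∈ (W : Finset ι), a i :=
      (Finset.sum_sdiff hsub).symm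
    have hTle : ∑ i ∈ φ W \ (W : Finset ι), a i ≤ (φ W \ (W : Finset ι)).card * s := by
      simpa only [smul_eq_mul] using Finset.sum_le_card_nsmul _ _ _ fun i _ => hsize i
    by_contra hcon
    have hck : (φ W \ (W : Finset ι)).card ≤ k - 1 := by omega
    have : (φ W \ (W : Finset ι)).card * s ≤ (k - 1) * s := Nat.mul_le_mul_right s hck
    omega
  have hsum : g₀ ^ k * ∑ W : {W : Finset ι // ∑ i ∈ W, ar i < (ℓ : ℝ) + 1 / 2},
        (∏ t, if t ∈ (W : Finset ι) then p t else 1 - p t) ≤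
      (1 - g₀) ^ k * ∑ W : {W : Finset ι // ∑ i ∈ W, ar i < (ℓ : ℝ) + 1 / 2},
        (∏ t, if t ∈ φ W then p t else 1 - p t) := by
    rw [Finset.mul_sum, Finset.mul_sum]
    exact Finset.sum_le_sum fun W _ => weight_transport_pow hhalf hg₀1 hp hp1 (hφ W).1 k (hcard W)
  have himage : ∑ W : {W : Finset ι // ∑ i ∈ W, ar i < (ℓ : ℝ) + 1 / 2}, (∏ t, if t ∈ φ W then p t else 1 - p t) ≤
      ∑ V ∈ (Finset.univ : Finset (Finset ι)).filter (fun V => m ≤ ∑ i ∈ V, a i),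
        (∏ t, if t ∈ V then p t else 1 - p t) := by
    rw [← Finset.sum_image (f := fun V : Finset ι => ∏ t, if t ∈ V then p t else 1 - p t) (s := Finset.univ) (g := φ)
      fun x _ y _ hxy => hφinj hxy]
    refine Finset.sum_le_sum_of_subset_of_nonneg (fun V hV => ?_) fun V _ _ => hw0 V
    rw [Finset.mem_image] at hV
    obtain ⟨W, -, rfl⟩ := hV
    rw [Finset.mem_filter]
    exact ⟨Finset.mem_univ _, hheavy_of (φ W) (hφ W).2⟩
  rw [hLeq]
  exact hsum.trans (mul_le_mul_of_nonneg_left himage (pow_nonneg h1g₀ k))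

/-! ### 2. The pure-mass row -/

/-- **The pure-mass bound on the lower tail.**  Sizes `≤ s`, gates `≥ g₀ ≥ 1/2`, total mass `≥ 2j + 1 + (k − 1)s` ⟹
`g₀^k · P(N ≤ j) ≤ (1 − g₀)^k` (transport T(j, Σa − j), the target probability bounded by `1`). [this work] -/
theorem lowerTail_le_of_mass (p : ι → ℝ) (a : ι → ℕ) (g₀ : ℝ) (hhalf : 1 / 2 ≤ g₀) (hp : ∀ i, g₀ ≤ p i) (hp1 : ∀ i, p i ≤ 1)
    (j s k : ℕ) (hsize : ∀ i, a i ≤ s) (hmass : 2 * j + 1 + (k - 1) * s ≤ ∑ i, a i) :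
    g₀ ^ k * (∑ W ∈ (Finset.univ : Finset (Finset ι)).filter (fun W => ∑ i ∈ W, a i ≤ j),
        (∏ t, if t ∈ W then p t else 1 - p t)) ≤ (1 - g₀) ^ k := by
  have hg₀0 : 0 < g₀ := by linarith
  have hw0 : ∀ W : Finset ι, 0 ≤ (∏ t, if t ∈ W then p t else 1 - p t) :=
    bernoulliWeight_nonneg (fun i => hg₀0.le.trans (hp i)) hp1
  have htr := transport_two_tails p a g₀ hhalf hp hp1 j ((∑ i, a i) - j) s k (by omega) hsize (by omega)
  have hH1 : ∑ V ∈ (Finset.univ : Finset (Finset ι)).filter (fun V => (∑ i, a i) - j ≤ ∑ i ∈ V, a i),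
      (∏ t, if t ∈ V then p t else 1 - p t) ≤ 1 :=
    (Finset.sum_le_sum_of_subset_of_nonneg (Finset.filter_subset _ _) fun W _ _ => hw0 W).trans_eq (sum_bernoulliWeight p)
  have hg₀1 : g₀ ≤ 1 := by
    rcases (Finset.univ : Finset ι).eq_empty_or_nonempty with h | ⟨i, -⟩
    · exfalso
      rw [h, Finset.sum_empty] at hmass
      omega
    · exact (hp i).trans (hp1 i)
  exact htr.trans (mul_le_of_le_one_right (pow_nonneg (by linarith) k) hH1)

end IndepBlob

namespace RootDec

open Finset

variable {κ : Type} [Fintype κ] [DecidableEq κ]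

/-- product-Bernoulli weight of the set `W` of open blobs (as in `…QuantRootReduction`) -/
local notation3 "wt[" g ", " W "]" => ∏ k, (if k ∈ (W : Finset κ) then (g : κ → ℝ) k else 1 - (g : κ → ℝ) k)

/-- the TERM tail `P(s + Σ_{k open} a k ≥ j+1)` (as in `…QuantRootReduction`) -/
local notation3 "TERM[" s ", " a ", " g ", " j "]" =>
  ∑ W : Finset κ, wt[g, W] * (if (j : ℕ) + 1 ≤ (s : ℕ) + ∑ k ∈ W, (a : κ → ℕ) k then (1 : ℝ) else 0)

/-- **THE PURE-MASS ROW of Conjecture DIB\* (floors `17/20 ≤ x ≤ 1`).**  Gates in `[x², 1]`, every size `≤ s`, total mass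
`≥ 2j + 1 + s` ⟹ `x ≤ P(N ≥ j+1)` — whatever the credit, whatever the largest blob: `x⁴·P(N ≤ j) ≤ (1 − x²)² ≤ (1 − x)·x⁴`.
[this work] -/
theorem tail_ge_of_mass (a : κ → ℕ) (g : κ → ℝ) (j s : ℕ) (x : ℝ) (hx : 17 / 20 ≤ x) (hx1 : x ≤ 1)
    (hg : ∀ i, 0 ≤ g i ∧ g i ≤ 1) (hfloor : ∀ i, x ^ 2 ≤ g i) (hsize : ∀ i, a i ≤ s)
    (hmass : 2 * j + 1 + s ≤ ∑ i, a i) :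
    x ≤ ∑ W : Finset κ, wt[g, W] * (if j + 1 ≤ ∑ i ∈ W, a i then (1 : ℝ) else 0) := by
  have hhalf : 1 / 2 ≤ x ^ 2 := by nlinarith
  have hx0 : 0 < x := by linarith
  have hL := IndepBlob.lowerTail_le_of_mass g a (x ^ 2) hhalf hfloor (fun i => (hg i).2) j s 2 hsize (by simpa using hmass)
  have hρ := transport_floor_two x hx hx1
  -- `P(N ≥ j+1) = 1 − P(N ≤ j)`
  set L : ℝ := ∑ W ∈ (Finset.univ : Finset (Finset κ)).filter (fun W => ∑ i ∈ W, a i ≤ j), wt[g, W] with hLdef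
  have hsplit : ∑ W : Finset κ, wt[g, W] * (if j + 1 ≤ ∑ i ∈ W, a i then (1 : ℝ) else 0) = 1 - L := by
    rw [hLdef, Finset.sum_filter, eq_sub_iff_add_eq, ← Finset.sum_add_distrib]
    refine Eq.trans (Finset.sum_congr rfl fun W _ => ?_) (IndepBlob.sum_bernoulliWeight g)
    by_cases h : j + 1 ≤ ∑ i ∈ W, a i
    · rw [if_pos h, if_neg (by omega), mul_one, add_zero]
    · rw [if_neg h, if_pos (by omega), mul_zero, zero_add]
  rw [hsplit]
  -- `x⁴ L ≤ (1 − x²)² ≤ (1 − x) x⁴`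
  have hc0 : 0 < (x ^ 2) ^ 2 := by positivity
  have h1 : (x ^ 2) ^ 2 * L ≤ (x ^ 2) ^ 2 * (1 - x) := by linarith
  have h2 : L ≤ 1 - x := le_of_mul_le_mul_left h1 hc0
  linarith

/-! ### 3. The largest-blob split with a strong rest (rest mean `> 2j`) -/

/-- The floor polynomial of the light-largest cell: for `43/50 ≤ x ≤ 1`, `0 ≤ 2x³ + 2x² − 2x − 1` (value `0.031` at `x = 43/50`)
and `(1 − x²)² ≤ (1 − x)·(x²)²`. [this work] -/
theorem transport_floor_restMean (x : ℝ) (hx : 43 / 50 ≤ x) (hx1 : x ≤ 1) :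
    0 ≤ 2 * x ^ 3 + 2 * x ^ 2 - 2 * x - 1 ∧ (1 - x ^ 2) ^ 2 ≤ (1 - x) * (x ^ 2) ^ 2 := by
  have hx0 : 0 ≤ x := by linarith
  have h2 : (43 / 50) * x ≤ x ^ 2 := by nlinarith [mul_nonneg hx0 (sub_nonneg.2 hx)]
  have h3 : (43 / 50) ^ 2 * x ≤ x ^ 3 := by
    have := mul_le_mul_of_nonneg_left h2 hx0
    nlinarith
  refine ⟨by nlinarith, transport_floor_two x (by linarith) hx1⟩

/-- **THE LIGHT-LARGEST CELL WITH A STRONG REST — floors `43/50 ≤ x < 1`.**  Gates in `[x², 1]`; a blob `k₀` of maximal size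
with `a k₀ ≤ j` and ANY gate (light or heavy); the REST has mean `> 2j` (`Σ_{i ≠ k₀} a i·g i > 2j`).  Then `x ≤ P(N ≥ j+1)`.
Heavy `k₀`: `tail_ge_of_heavyLargest`.  Light `k₀` (`p < x`): the half-mean small-ball inequality for the rest
(`IndepBlob.far_indepBlob`, least gate `≥ x²`) certifies `H ≥ x²`, `term_ge_of_transport_lower` gives
`x⁴·P ≥ x⁴p + x²(x⁴(1 − p) − p(1 − x²)²)`, increasing in `p`, and at `p = x²` this is `≥ x⁴·x` iff `4x² − 2x⁴ − 1 − x =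
(1 − x)(2x³ + 2x² − 2x − 1) ≥ 0`. [this work] -/
theorem tail_ge_of_largest_restMean (a : κ → ℕ) (g : κ → ℝ) (j : ℕ) (x : ℝ) (hx : 43 / 50 ≤ x) (hx1 : x < 1)
    (hg : ∀ i, 0 ≤ g i ∧ g i ≤ 1) (hfloor : ∀ i, x ^ 2 ≤ g i) (k₀ : κ)
    (hlargest : ∀ i, a i ≤ a k₀) (hkj : a k₀ ≤ j)
    (hmean : (2 * j : ℝ) + (a k₀ : ℝ) * g k₀ < ∑ i, (a i : ℝ) * g i) :
    x ≤ ∑ W : Finset κ, wt[g, W] * (if j + 1 ≤ ∑ i ∈ W, a i then (1 : ℝ) else 0) := by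
  have hx0 : 0 < x := by linarith
  obtain ⟨hpoly, hρ⟩ := transport_floor_restMean x hx hx1.le
  have hhalf : 1 / 2 ≤ x ^ 2 := by nlinarith
  -- the rest and its mean
  set a' : κ → ℕ := Function.update a k₀ 0 with ha'
  have ha'k : a' k₀ = 0 := by rw [ha', Function.update_self]
  have ha'ne : ∀ i, i ≠ k₀ → a' i = a i := fun i hi => by rw [ha', Function.update_of_ne hi]
  have hrest_mean : (2 * j : ℝ) < ∑ i, (a' i : ℝ) * g i := by
    have h1 : ∑ i, (a i : ℝ) * g i = (a k₀ : ℝ) * g k₀ + ∑ i ∈ Finset.univ.erase k₀, (a i : ℝ) * g i :=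
      (Finset.add_sum_erase _ _ (Finset.mem_univ k₀)).symm
    have h2 : ∑ i, (a' i : ℝ) * g i = (a' k₀ : ℝ) * g k₀ + ∑ i ∈ Finset.univ.erase k₀, (a' i : ℝ) * g i :=
      (Finset.add_sum_erase _ _ (Finset.mem_univ k₀)).symm
    have h3 : ∑ i ∈ Finset.univ.erase k₀, (a' i : ℝ) * g i = ∑ i ∈ Finset.univ.erase k₀, (a i : ℝ) * g i :=
      Finset.sum_congr rfl fun i hi => by rw [ha'ne i (Finset.ne_of_mem_erase hi)]
    rw [h2, h3, ha'k, Nat.cast_zero, zero_mul, zero_add]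
    linarith
  -- total mass `≥ 2j + 1` (the rest alone has mean, hence mass, `> 2j`)
  have hmass : 2 * j + 1 ≤ ∑ i, a i := by
    have h1 : ∑ i, (a' i : ℝ) * g i ≤ ∑ i, (a' i : ℝ) :=
      Finset.sum_le_sum fun i _ => mul_le_of_le_one_right (Nat.cast_nonneg _) (hg i).2
    have h2 : ∑ i, (a' i : ℝ) ≤ ∑ i, (a i : ℝ) := Finset.sum_le_sum fun i _ => by
      by_cases hi : i = k₀
      · rw [hi, ha'k, Nat.cast_zero]; exact Nat.cast_nonneg _
      · rw [ha'ne i hi]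
    have h3 : ((2 * j : ℕ) : ℝ) < ((∑ i, a i : ℕ) : ℝ) := by push_cast; linarith
    have h4 : 2 * j < ∑ i, a i := by exact_mod_cast h3
    omega
  by_cases hheavy : x ≤ g k₀
  · exact tail_ge_of_heavyLargest a g j x (by linarith) hx1.le hg hfloor k₀ hheavy hlargest hkj hmass
  have hpx : g k₀ < x := not_le.1 hheavy
  -- `H ≥ x²` by the half-mean small-ball inequality for the rest (least gate `≥ x²`, mean `> 2j`)
  have hH : x ^ 2 ≤ ∑ W : Finset κ, wt[g, W] * (if j + 1 ≤ ∑ i ∈ W, a' i then (1 : ℝ) else 0) := by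
    have hfar := IndepBlob.far_indepBlob g (fun i => (a' i : ℝ)) (x ^ 2) 0 (by positivity) (by nlinarith)
      hfloor (fun i => (hg i).2) (fun i => Nat.cast_nonneg _) le_rfl (j : ℝ) (by rw [zero_mul, zero_add]; exact hrest_mean)
    -- `hfar : x²·P(N' + 0 ≤ j) + (1 − x²)·P(N' ≤ j) ≤ 1 − x²`
    have hw0 : ∀ W : Finset κ, 0 ≤ wt[g, W] := IndepBlob.bernoulliWeight_nonneg (fun i => (hg i).1) (fun i => (hg i).2)
    set F : ℝ := ∑ W ∈ (Finset.univ : Finset (Finset κ)).filter (fun W => ∑ i ∈ W, (a' i : ℝ) ≤ (j : ℝ)), wt[g, W] with hF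
    have hF' : ∑ W ∈ (Finset.univ : Finset (Finset κ)).filter (fun W => ∑ i ∈ W, (a' i : ℝ) + 0 ≤ (j : ℝ)), wt[g, W] = F := by
      rw [hF]
      refine Finset.sum_congr ?_ fun _ _ => rfl
      ext W; simp only [Finset.mem_filter, add_zero]
    rw [hF'] at hfar
    have hFle : F ≤ 1 - x ^ 2 := by nlinarith
    -- `P(N' ≥ j+1) = 1 − F`
    have hsplit : ∑ W : Finset κ, wt[g, W] * (if j + 1 ≤ ∑ i ∈ W, a' i then (1 : ℝ) else 0) = 1 - F := by
      rw [hF, Finset.sum_filter, eq_sub_iff_add_eq, ← Finset.sum_add_distrib]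
      refine Eq.trans (Finset.sum_congr rfl fun W _ => ?_) (IndepBlob.sum_bernoulliWeight g)
      have hc : ∑ i ∈ W, (a' i : ℝ) = ((∑ i ∈ W, a' i : ℕ) : ℝ) := by rw [Nat.cast_sum]
      by_cases h : j + 1 ≤ ∑ i ∈ W, a' i
      · have hn : ¬ (∑ i ∈ W, (a' i : ℝ) ≤ (j : ℝ)) := by
          rw [hc, not_le]; exact_mod_cast h
        rw [if_pos h, if_neg hn, mul_one, add_zero]
      · have hy : ∑ i ∈ W, (a' i : ℝ) ≤ (j : ℝ) := by
          rw [hc]; exact_mod_cast (by omega : ∑ i ∈ W, a' i ≤ j)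
        rw [if_neg h, if_pos hy, mul_zero, zero_add]
    rw [hsplit]; linarith
  -- the master rule with `g₀ = x²`, `k = 2`, `h = x²`
  have hsign : g k₀ * (1 - x ^ 2) ^ 2 ≤ (1 - g k₀) * (x ^ 2) ^ 2 := by
    -- `p ≤ x` and `(1 − x²)² ≤ (1 − x)x⁴ ≤ (1 − p)x⁴`, `p(1−x)x⁴ ≤ (1−p)x⁴`? use `p·d ≤ d ≤ (1−x)c ≤ (1−p)c`
    have hd0 : 0 ≤ (1 - x ^ 2) ^ 2 := sq_nonneg _
    have hc0 : 0 ≤ (x ^ 2) ^ 2 := by positivity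
    nlinarith [(hg k₀).2, mul_le_mul_of_nonneg_right (by linarith : 1 - x ≤ 1 - g k₀) hc0]
  have hmain := term_ge_of_transport_lower a g j (x ^ 2) (x ^ 2) k₀ (a k₀) 2 hg hhalf hfloor hkj
    (fun i _ => hlargest i) (by omega) hmass hsign hH
  -- real arithmetic: `x⁴ x ≤ x⁴ p + x²(x⁴(1 − p) − p(1 − x²)²)` for `x² ≤ p ≤ x`
  set p : ℝ := g k₀ with hp
  have hplo : x ^ 2 ≤ p := hfloor k₀
  have hc0 : 0 < (x ^ 2) ^ 2 := by positivity
  have key : (x ^ 2) ^ 2 * p + x ^ 2 * ((x ^ 2) ^ 2 * (1 - p) - p * (1 - x ^ 2) ^ 2) - (x ^ 2) ^ 2 * x =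
      x ^ 4 * ((1 - x) * (2 * x ^ 3 + 2 * x ^ 2 - 2 * x - 1)) + (p - x ^ 2) * (x ^ 2 * (1 - x ^ 2) * (2 * x ^ 2 - 1)) := by
    ring
  have hslope : 0 ≤ x ^ 2 * (1 - x ^ 2) * (2 * x ^ 2 - 1) := by
    have : 0 ≤ 1 - x ^ 2 := by nlinarith
    have : 0 ≤ 2 * x ^ 2 - 1 := by nlinarith
    positivity
  have hconst : 0 ≤ x ^ 4 * ((1 - x) * (2 * x ^ 3 + 2 * x ^ 2 - 2 * x - 1)) := by
    have : 0 ≤ (1 - x) * (2 * x ^ 3 + 2 * x ^ 2 - 2 * x - 1) := mul_nonneg (by linarith) hpoly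
    positivity
  have hfinal : (x ^ 2) ^ 2 * x ≤ (x ^ 2) ^ 2 * p + x ^ 2 * ((x ^ 2) ^ 2 * (1 - p) - p * (1 - x ^ 2) ^ 2) := by
    nlinarith [mul_nonneg (sub_nonneg.2 hplo) hslope]
  exact le_of_mul_le_mul_left (hfinal.trans hmain) hc0

end RootDec

end Quant

end Summit.CriticalPhenomena.PercolationContinuityZ3.Theorems
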